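import Summits.QuantumFields.YangMills.Theorems.UnitScaleTiltProp7LegLemmaQTw
import Summits.QuantumFields.YangMills.Theorems.UnitScaleTiltProp7CovIterLambdaHLambdaBridge
import HarnessLib

/-!
# `UnitScaleTiltProp7RLegsOfCovGrad` — LANE II (B4★)∕(QB), supplier (R-LEGS): **THE CURVED CORNER-FRAME LEGS ROW `rlegs` FOLLOWS FROM ITS COVARIANT-GRADIENT FORM `rlegs_cov` BY THE
# LATTICE WEITZENBÖCK INEQUALITY** — the curl∕divergence∕curvature bookkeeping of px19 g6's SIGNATURE-0 text `rlegs` (1cfeb477) is DISCHARGED BY NAME, leaving as the one analytic row the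
# covariant twin of `rlegs_flat` with the FULL operator-norm covariant gradient energy on the right (crux `MinimiserStabilityRegPr`, stmt-QuantumFields-19200, EX lane, hN06 LANE II;
# `--supports stmt-QuantumFields-19200 --as helper`, count-neutral)

Cell `ym3-torus` (HUMAN RULING D-0037: YM₃ on T³ is ladder rung R3 — NOT d = 4, NOT infinite volume, NOT a mass gap, NOT the Clay problem), width seat `ym-ust-20520-w4` (g12).
THEOREMS ONLY (0 `def`, 0 `sorry`); registry ∕ skeleton texts untouched; nothing here claims (R-LEGS), (QB), (REC), `hN06`, EX or the crux.

WHY.  px19 g6's (R-LEGS) text (SIGNATURE-0 `Prop7RLegsTexts.rlegs`, HOME `ym3-torus-px19/g6/SIGNATURE0-RLEGS-texts.px19g6.lean` 1cfeb477) bounds the coarse covariant gradient of the corner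
frames' linear response `r y := fderiv (A ↦ ↑(frameTw W A y)) 0` by `Cr·ℓ·(CURL_HS + DIV_HS)(A) + Cr′·e·ℓ⁻¹·Σ‖A b‖²`.  Its mechanism of record (px19 g6 07:49:25Z: nested covariant means +
box Poincaré, «same skeleton as the flat certificate with `Ad(Ū)` transports») naturally produces the FULL covariant gradient energy
`Σ_{b,ν}‖W(b.src,ν)·A(b+ν)·W(b.src,ν)ᴴ − A(b)‖²` on the right; the passage to `CURL_HS + DIV_HS` is EXACTLY ★routeR-w2's ✓`Prop7CovIterLambdaHLambdaBridge.sum_normSq_covGrad_le_curl_divB`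
(the op-norm Weitzenböck inequality `Σ‖∇^{W}A‖² ≤ CURL_HS + DIV_HS + 2d·a·N·Σ‖A‖²` for `dist1(W(∂p)) ≤ a`, [Balaban1985Variational] (135)) at `a := regThreshold F n K e = e·L^{−2(K−n)}`
(print's regular space, `RegPr.plaqSmall`), whose curvature term `Cr·ℓ·(2·3·e·ℓ⁻²·2)·Σ‖A‖² = 12·Cr·e·ℓ⁻¹·Σ‖A‖²` lands in the `Cr′` slot.  THIS FILE is that door:

* ★★★ **`rlegs_of_covGradLegs (hCov) : <px19's rlegs text VERBATIM>`**, `hCov` = the same text with `CURL_HS + DIV_HS` replaced by the covariant gradient energy (displayed below as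
  the one hypothesis; constants `Cr ↦ Cr`, `Cr′ ↦ Cr′ + 12·Cr`, `er ↦ er`).

HONEST SCOPE.  Bookkeeping over one landed inequality; `hCov` (the covariant twin of `rlegs_flat`) is an OPEN row with a named pen (px19 g6 ∕ successor; w4-20520 g12 second hand); nothing
of it is asserted here.  Rung R3; nothing of the crux ∕ the gap is claimed.

References: T. Bałaban, CMP 102 (1985) 277–309 [Balaban1985Variational] ((135) p.298, (6) p.278); CMP 99 (1985) 389–434 [Balaban1985BackgroundPropagators] ((3.8)–(3.10) p.392,
(3.14)–(3.15) p.393); CMP 98 (1985) 17–51 [Balaban1985Averaging] ((89)–(92) p.31, (97) p.32, (160) p.42).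
-/

set_option autoImplicit false

noncomputable section

open scoped BigOperators Matrix.Norms.L2Operator Matrix

namespace Summit.QuantumFields.YangMills.Theorems.Prop7RLegsOfCovGrad

open Literature.MathematicalPhysics.QuantumFieldTheory.Balaban1983to89
open Literature.MathematicalPhysics.QuantumFieldTheory.Balaban1983to89.T3ContinuumYM3Torus
open Literature.MathematicalPhysics.QuantumFieldTheory.Balaban1983to89.T3PrintedRegularMinimiser (RegPr)
open T3RegularMinimiser (regThreshold)
open T4Continuum BlockAveraging AveragingRT ExpMeanLog
open T3LevelShift (bondShift)
open T3PrintedRegularOrbits (sites_eq)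
open B9Eq39Adjoint (curl divB)
open B10Eq27TorusAxialLog (unitsField toUField)
open B9TorusCalculus (torusT)
open Summit.QuantumFields.YangMills.Theorems.Prop7SymAvgTw (frameTw)
open Summit.QuantumFields.YangMills.Theorems.Prop7CovIterLambdaHLambdaBridge (sum_normSq_covGrad_le_curl_divB)

/-- ★★★ **(R-LEGS) ⟸ (R-LEGS-cov) BY THE LATTICE WEITZENBÖCK INEQUALITY.**  If the coarse covariant gradient of the corner frames' linear response is bounded by `Cr·ℓ` times the FULL
operator-norm covariant gradient energy of `A` plus `Cr′·e·ℓ⁻¹·Σ‖A‖²` on print's regular space (hypothesis `hCov`, the covariant twin of px19 g6's `rlegs_flat`), then px19 g6's displayed row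
`rlegs` holds VERBATIM with `(Cr, Cr′ + 12·Cr, er)`: ✓`sum_normSq_covGrad_le_curl_divB` at `a := regThreshold F n K e = e·L^{−2(K−n)}` (`RegPr.plaqSmall`, `d = 3`, `N = 2`), and
`L^{K−n}·(2·3·(e·L^{−2(K−n)})·2) = 12·e·(L^{K−n})⁻¹`.
[cite: Balaban1985Variational, (135) p.298, (6) p.278; Balaban1985BackgroundPropagators, (3.8)-(3.10) p.392, (3.14)-(3.15) p.393; Balaban1985Averaging, (89)-(92) p.31, (97) p.32, (160) p.42] -/
theorem rlegs_of_covGradLegs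
    (hCov : ∀ (L : ℕ), 1 < L → ∃ Cr Cr' er : ℝ, 0 ≤ Cr ∧ 0 ≤ Cr' ∧ 0 < er ∧
      ∀ (F : T3Family), F.L = L → ∀ (n K : ℕ) (hnK : n < K) (e : ℝ) (W : GaugeField (F.P K) 0 (Matrix.specialUnitaryGroup (Fin 2) ℂ)),
        0 < e → e ≤ er → RegPr F n K e W → ∀ (A : PBond (F.P K) 0 → Matrix (Fin 2) (Fin 2) ℂ),
        ∑ c : PBond (F.P n) 0,
          ‖fderiv ℂ (fun A : PBond (F.P K) 0 → Matrix (Fin 2) (Fin 2) ℂ => ((frameTw F n K hnK.le W A c.src : (Matrix (Fin 2) (Fin 2) ℂ)ˣ) : Matrix (Fin 2) (Fin 2) ℂ)) 0 A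
              - ((Averaging.iter (fun i => blockAvg (P := F.P K) (j := i) (expMeanLogSU (n := Fin 2))) (K - n) W (bondShift (sites_eq F n K hnK.le) c) :
                  Matrix.specialUnitaryGroup (Fin 2) ℂ) : Matrix (Fin 2) (Fin 2) ℂ)
                * fderiv ℂ (fun A : PBond (F.P K) 0 → Matrix (Fin 2) (Fin 2) ℂ => ((frameTw F n K hnK.le W A c.tgt : (Matrix (Fin 2) (Fin 2) ℂ)ˣ) : Matrix (Fin 2) (Fin 2) ℂ)) 0 A
                * star ((Averaging.iter (fun i => blockAvg (P := F.P K) (j := i) (expMeanLogSU (n := Fin 2))) (K - n) W (bondShift (sites_eq F n K hnK.le) c) :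
                  Matrix.specialUnitaryGroup (Fin 2) ℂ) : Matrix (Fin 2) (Fin 2) ℂ)‖ ^ 2
          ≤ Cr * (F.L : ℝ) ^ (K - n) * (∑ b : PBond (F.P K) 0, ∑ ν : Fin (F.P K).d,
                ‖((W ⟨b.src, ν⟩ : Matrix.specialUnitaryGroup (Fin 2) ℂ) : Matrix (Fin 2) (Fin 2) ℂ) * A ⟨b.src.shift ν, b.dir⟩
                    * star ((W ⟨b.src, ν⟩ : Matrix.specialUnitaryGroup (Fin 2) ℂ) : Matrix (Fin 2) (Fin 2) ℂ) - A b‖ ^ 2)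
            + Cr' * e * ((F.L : ℝ) ^ (K - n))⁻¹ * ∑ b : PBond (F.P K) 0, ‖A b‖ ^ 2) :
    ∀ (L : ℕ), 1 < L → ∃ Cr Cr' er : ℝ, 0 ≤ Cr ∧ 0 ≤ Cr' ∧ 0 < er ∧
    ∀ (F : T3Family), F.L = L → ∀ (n K : ℕ) (hnK : n < K) (e : ℝ) (W : GaugeField (F.P K) 0 (Matrix.specialUnitaryGroup (Fin 2) ℂ)),
      0 < e → e ≤ er → RegPr F n K e W → ∀ (A : PBond (F.P K) 0 → Matrix (Fin 2) (Fin 2) ℂ),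
      ∑ c : PBond (F.P n) 0,
        ‖fderiv ℂ (fun A : PBond (F.P K) 0 → Matrix (Fin 2) (Fin 2) ℂ => ((frameTw F n K hnK.le W A c.src : (Matrix (Fin 2) (Fin 2) ℂ)ˣ) : Matrix (Fin 2) (Fin 2) ℂ)) 0 A
            - ((Averaging.iter (fun i => blockAvg (P := F.P K) (j := i) (expMeanLogSU (n := Fin 2))) (K - n) W (bondShift (sites_eq F n K hnK.le) c) :
                Matrix.specialUnitaryGroup (Fin 2) ℂ) : Matrix (Fin 2) (Fin 2) ℂ)
              * fderiv ℂ (fun A : PBond (F.P K) 0 → Matrix (Fin 2) (Fin 2) ℂ => ((frameTw F n K hnK.le W A c.tgt : (Matrix (Fin 2) (Fin 2) ℂ)ˣ) : Matrix (Fin 2) (Fin 2) ℂ)) 0 A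
              * star ((Averaging.iter (fun i => blockAvg (P := F.P K) (j := i) (expMeanLogSU (n := Fin 2))) (K - n) W (bondShift (sites_eq F n K hnK.le) c) :
                Matrix.specialUnitaryGroup (Fin 2) ℂ) : Matrix (Fin 2) (Fin 2) ℂ)‖ ^ 2
        ≤ Cr * (F.L : ℝ) ^ (K - n) * ((∑ x : Site (F.P K) 0, ∑ μ : Fin (F.P K).d, ∑ ν : Fin (F.P K).d,
              (if μ < ν then ∑ j : Fin 2, ∑ k : Fin 2,
                ‖(curl (torusT (F.P K) 0) (fun κ z => unitsField (toUField W) ⟨z, κ⟩) (fun κ z => A ⟨z, κ⟩) μ ν x) j k‖ ^ 2 else 0))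
            + (∑ x : Site (F.P K) 0, ∑ j : Fin 2, ∑ k : Fin 2,
              ‖(divB (torusT (F.P K) 0) (fun κ z => unitsField (toUField W) ⟨z, κ⟩) (fun κ z => A ⟨z, κ⟩) x) j k‖ ^ 2))
          + Cr' * e * ((F.L : ℝ) ^ (K - n))⁻¹ * ∑ b : PBond (F.P K) 0, ‖A b‖ ^ 2 := by
  intro L hL
  obtain ⟨Cr, Cr', er, hCr, hCr', her, hrow⟩ := hCov L hL
  refine ⟨Cr, Cr' + 12 * Cr, er, hCr, by positivity, her, ?_⟩
  intro F hF n K hnK e W he heer hreg A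
  have hd : (F.P K).d = 3 := T3Family.P_d F K
  have hLL : ((F.P K).L : ℝ) = F.L := rfl
  have hL0 : (0 : ℝ) < (F.L : ℝ) := by rw [hF]; exact_mod_cast (lt_trans Nat.zero_lt_one hL)
  -- abbreviations
  set G : ℝ := ∑ b : PBond (F.P K) 0, ∑ ν : Fin (F.P K).d,
      ‖((W ⟨b.src, ν⟩ : Matrix.specialUnitaryGroup (Fin 2) ℂ) : Matrix (Fin 2) (Fin 2) ℂ) * A ⟨b.src.shift ν, b.dir⟩
          * star ((W ⟨b.src, ν⟩ : Matrix.specialUnitaryGroup (Fin 2) ℂ) : Matrix (Fin 2) (Fin 2) ℂ) - A b‖ ^ 2 with hG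
  set CD : ℝ := (∑ x : Site (F.P K) 0, ∑ μ : Fin (F.P K).d, ∑ ν : Fin (F.P K).d,
        (if μ < ν then ∑ j : Fin 2, ∑ k : Fin 2,
          ‖(curl (torusT (F.P K) 0) (fun κ z => unitsField (toUField W) ⟨z, κ⟩) (fun κ z => A ⟨z, κ⟩) μ ν x) j k‖ ^ 2 else 0))
      + (∑ x : Site (F.P K) 0, ∑ j : Fin 2, ∑ k : Fin 2,
        ‖(divB (torusT (F.P K) 0) (fun κ z => unitsField (toUField W) ⟨z, κ⟩) (fun κ z => A ⟨z, κ⟩) x) j k‖ ^ 2) with hCD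
  set SA : ℝ := ∑ b : PBond (F.P K) 0, ‖A b‖ ^ 2 with hSA
  have hSA0 : 0 ≤ SA := by rw [hSA]; positivity
  -- the Weitzenböck inequality at `a := regThreshold F n K e`
  have hreg0 : 0 ≤ regThreshold F n K e := by unfold regThreshold; positivity
  have hW := sum_normSq_covGrad_le_curl_divB (P := F.P K) (N := 2) (i := 0) W hreg0 (fun p => (hreg.plaqSmall p).le) A
  have hGle : G ≤ CD + 2 * (F.P K).d * regThreshold F n K e * (2 * SA) := by
    rw [hG, hCD, hSA]
    have h := hW
    push_cast at h ⊢
    linarith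
  -- the curvature term: `Cr·ℓ·(2·3·(e·ℓ⁻²)·2·SA) = 12·Cr·e·ℓ⁻¹·SA`
  have hℓ0 : (0 : ℝ) < (F.L : ℝ) ^ (K - n) := pow_pos hL0 _
  have hcurv : Cr * (F.L : ℝ) ^ (K - n) * (2 * (F.P K).d * regThreshold F n K e * (2 * SA))
      = 12 * Cr * e * ((F.L : ℝ) ^ (K - n))⁻¹ * SA := by
    rw [hd]
    unfold regThreshold
    push_cast
    have hne : (F.L : ℝ) ^ (K - n) ≠ 0 := hℓ0.ne'
    have h2 : ((F.L : ℝ) ^ (2 * (K - n)))⁻¹ = ((F.L : ℝ) ^ (K - n))⁻¹ * ((F.L : ℝ) ^ (K - n))⁻¹ := by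
      rw [← mul_inv, ← pow_add, two_mul]
    simp only [inv_pow, h2]
    field_simp
    ring
  have hmain := hrow F hF n K hnK e W he heer hreg A
  calc _ ≤ Cr * (F.L : ℝ) ^ (K - n) * G + Cr' * e * ((F.L : ℝ) ^ (K - n))⁻¹ * SA := hmain
    _ ≤ Cr * (F.L : ℝ) ^ (K - n) * (CD + 2 * (F.P K).d * regThreshold F n K e * (2 * SA)) + Cr' * e * ((F.L : ℝ) ^ (K - n))⁻¹ * SA := by
        have := mul_le_mul_of_nonneg_left hGle (by positivity : (0 : ℝ) ≤ Cr * (F.L : ℝ) ^ (K - n))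
        linarith
    _ = Cr * (F.L : ℝ) ^ (K - n) * CD + (Cr' + 12 * Cr) * e * ((F.L : ℝ) ^ (K - n))⁻¹ * SA := by
        rw [mul_add, hcurv]; ring

end Summit.QuantumFields.YangMills.Theorems.Prop7RLegsOfCovGrad

end
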